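import Summits.ABC.IUTFork.Thm311RealInd1UnitsRealisationBall
import HarnessLib

/-!
# The unit-group shear at `v₇ = (√7)` of `ℚ(√7)`, VII: THE UNCONDITIONAL REALISATION THEOREM — at
# `v₇` every `φ ∈ Aut_top(G_{v₇})` is realised through the analytic logarithm, so the (Ind1)-mover
# question IS the units-transport question

Record file (D-0012) of the abc-iut cell (TEAM R, lead seat abc-iut-c312-14 = R1, gen 10; row
«R9f-REALISATION», claimed plan/C312-TEAMS.md 2026-08-27T02:04:30Z); part 2 over
`Thm311RealInd1UnitsRealisationBall.lean`.  TAKES NO SIDE on [IUTchIII] Cor. 3.12.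

BACKGROUND.  GAP-LEDGER row G-c312-14-R9f, disposition rows D-G-c312-14-R9f (23:56:49Z) and
D-G-c312-14-R9f-2 (01:16:30Z), left open: (i) «type THE mono-anabelian functoriality ([AbsTopIII]
Prop. 3.2 (iv) = Hoshi [4, Prop. 3.11 (iv)]) at an abstract `φ` so the baseSeg-mover hypothesis
discharges from the published Lemma»; (ii′) the `∃`-horn at the `μ·U^{(2)}`-target in its weakest
sufficient form.  Every conditional (Ind1)-mover landed so far (`ind1_strip_mover_of_lift`,
`ind1_strip_moves_baseSeg_of_mover`, the `hnRealised` forms of p481593) carries, besides the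
units-transport clause, a REALISATION clause «∃ ψ bicontinuous with
`Realises v₇ L₇ (stripMulAut v₇ φ) ψ`».  THIS FILE PROVES THE REALISATION CLAUSE OUTRIGHT:

* **`exists_realises_stripMulAut`** — for EVERY `φ ∈ Aut_top(G_{v₇})` there is a bicontinuous
  additive automorphism `ψ` of `K_{v₇}` with `Realises v₇ L₇ (stripMulAut v₇ φ) ψ`; the witness
  `psiStrip φ` lies in print's (Ind1) strip part (`psiStrip_mem_ind1StripOf`).  Construction: the
  part-1 ball transport `psiBall φ` extends to `K₇ = ⋃ₙ 7^{-n}·B(0, ‖Ω‖)` by the scaling law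
  (`psiK`, coherence `psiK_eq_of_le`); the inverse is the same construction at `φ⁻¹`
  (`psiK_symm_psiK`); bicontinuity via the scaled-ball bound
  `‖y‖ ≤ ‖Ω‖^{2n+1} ⟹ ‖ψ y‖ ≤ ‖Ω‖^{2n+1}` (`norm_psiK_le_of_le`, `continuous_psiK`).

* **GAP step (i) DISCHARGED, stronger than asked**: the realisation/functoriality clause of the
  conditional movers is a THEOREM at `v₇`, not a typed hypothesis.
  `ind1_strip_moves_baseSeg_of_liftUnits_mover` needs ONLY «some `φ`'s units transport moves
  `unitPreimage L₇ baseSeg`» — EXACTLY the `L₇`-reading of the conclusion of Hoshi's Lemma 3.1 (v)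
  (his continuous `α^×` moving the base-field unit line), with no `ψ`, no `Realises`, no continuity
  clause left.  [cite: Hoshi2024IntrinsicHodgeTate, Lemma 3.1 (v) pp.10–11]

* **GAP step (ii′) SHARPENED**: `ind1_strip_moves_M2_of_liftUnits_mover` is the `∃`-horn of the row
  in its NEW weakest form (a units-level mover at the `μ·U^{(2)}`-target only); it subsumes the
  exact-shear form (`ind1_strip_mover_of_liftUnits_shear` re-derives `ind1_strip_mover_of_lift`'s
  conclusion) and makes the realisation clauses of p481593's `hnRealised` movers redundant.

* **ADJUDICATION READING** (Team R charter): at `v₇` the mono-anabelian functoriality imposes NO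
  constraint on print's (Ind1) strip action — the ENTIRE (Ind1)-mover question is the
  group-theoretic question about `Aut_top(G_{v₇}) ↷ 𝒪_{v₇}^×`.  Contrast local degree one, where
  the landed norm rigidity (`liftUnits_eq_self_of_localDeg_eq_one`) kills the TRANSPORT: the two
  results bracket WHERE (Ind1) content can sit — in `liftUnits`, never in the passage to the
  log-shell carrier.  Composing this file with negative results on `ind1StripOf` (e.g.
  `neg_not_mem_ind1StripOf_analyticLogv`-style) yields constraints on the TRANSPORT, exactly as
  norm rigidity (`norm_liftUnits_of_mem`) independently shows — consistency checked.

HONEST SCOPE.  All statements at the single tame quadratically ramified place `v₇` over THE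
analytic logarithm `L₇`; the constructed `ψ` is additive and bicontinuous, as print's
"ind-topological" reading requires, but is NOT claimed `ℚ₇`-linear, isometric, or canonical off the
log-lattice scaling tower; nothing is claimed at other places or for other logarithms; the `d = 2`
residual of the row (whether a base-line/`μ·U^{(2)}` MOVER `φ` exists — the valuation of the
Hoshi–Nishio shear scalar) stays open in both horns.  Fact-free (no new `Prop` facts, D-0067);
consumed BY NAME: part 1, the UnitsShear chain (R1 g7–g9), `liftUnits`/`stripMulAut`/`Realises`/
`ind1StripOf` (c312-1, Thm311RealInd1Strip), `unitPreimage`/`mem_unitPreimage_iff` (Ind2IsmRigid).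
[cite: MochizukiAbsTopIII2015, Proposition 3.2 (iv) p.72] [cite: NeukirchANT1999, Ch. II (5.4)–(5.5)]
[claim: Mochizuki2012, status: disputed] for every [IUTchIII] locution.  Nothing here asserts or
refutes [IUTchIII] Cor. 3.12; typed ≠ proved.
-/

set_option autoImplicit false

noncomputable section

namespace Summit.ABC.IUTFork.Thm311.Real.UnitsShear

open Literature.IUT.LogVolume Literature.NumberTheory.NumberFields
open NumberField IsDedekindDomain Metric IsUltrametricDist
open Summit.ABC.IUTFork.RamifiedMover
open Summit.ABC.IUTFork.Thm311.Real

/-! ## 4. Extension to `K₇ = ⋃ₙ 7^{-n}·B(0, ‖Ω‖)` -/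

/-- Every element of `K₇` is carried into the log-ball by a power of `7` (`‖7‖ = ‖Ω‖² < 1`).
[folklore] -/
theorem exists_seven_pow_mul_mem_ball (y : K7) : ∃ n : ℕ, ‖(7 : K7) ^ n * y‖ ≤ ‖Omega‖ := by
  obtain ⟨h0, h1⟩ := norm_omega_pos_lt_one
  rcases eq_or_ne y 0 with rfl | hy
  · exact ⟨0, by rw [mul_zero, norm_zero]; exact h0.le⟩
  · have hy0 : 0 < ‖y‖ := norm_pos_iff.mpr hy
    have hlt : ‖Omega‖ ^ 2 < 1 := by nlinarith
    obtain ⟨n, hn⟩ := exists_pow_lt_of_lt_one (show (0 : ℝ) < ‖Omega‖ / ‖y‖ by positivity) hlt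
    refine ⟨n, ?_⟩
    rw [norm_mul, norm_pow, norm_seven_K7]
    calc (‖Omega‖ ^ 2) ^ n * ‖y‖ ≤ ‖Omega‖ / ‖y‖ * ‖y‖ := by
          have := hn.le
          gcongr
      _ = ‖Omega‖ := div_mul_cancel₀ _ hy0.ne'

/-- The least exponent carrying `y` into the log-ball. [folklore] -/
def extN (y : K7) : ℕ := Nat.find (exists_seven_pow_mul_mem_ball y)

/-- Defining property of `extN`. [folklore] -/
theorem extN_spec (y : K7) : ‖(7 : K7) ^ extN y * y‖ ≤ ‖Omega‖ :=
  Nat.find_spec (exists_seven_pow_mul_mem_ball y)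

/-- Ball membership is monotone in the exponent (`‖7‖ ≤ 1`). [folklore] -/
theorem seven_pow_mul_mem_ball_of_le {y : K7} {n m : ℕ} (hnm : n ≤ m)
    (h : ‖(7 : K7) ^ n * y‖ ≤ ‖Omega‖) : ‖(7 : K7) ^ m * y‖ ≤ ‖Omega‖ := by
  obtain ⟨h0, h1⟩ := norm_omega_pos_lt_one
  obtain ⟨k, rfl⟩ := Nat.exists_eq_add_of_le hnm
  have hsplit : (7 : K7) ^ (n + k) * y = (7 : K7) ^ k * ((7 : K7) ^ n * y) := by ring
  rw [hsplit, norm_mul, norm_pow, norm_seven_K7]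
  have hle1 : (‖Omega‖ ^ 2) ^ k ≤ 1 := pow_le_one₀ (by positivity) (by nlinarith)
  calc (‖Omega‖ ^ 2) ^ k * ‖(7 : K7) ^ n * y‖ ≤ 1 * ‖Omega‖ := by
        refine mul_le_mul hle1 h (norm_nonneg _) zero_le_one
    _ = ‖Omega‖ := one_mul _

/-- **The global transported map `ψ_φ` on `K₇`**: `y ↦ 7^{-extN y}·psiBall φ (7^{extN y}·y)`.
[cite: MochizukiAbsTopIII2015, Proposition 3.2 (iv) p.72] -/
def psiK (φ : Gal v7 ≃ₜ* Gal v7) (y : K7) : K7 :=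
  ((7 : K7) ^ extN y)⁻¹ * psiBall φ ((7 : K7) ^ extN y * y)

/-- `psiK` unfolded. [folklore] -/
theorem psiK_def (φ : Gal v7 ≃ₜ* Gal v7) (y : K7) :
    psiK φ y = ((7 : K7) ^ extN y)⁻¹ * psiBall φ ((7 : K7) ^ extN y * y) := rfl

/-- **Coherence**: the value of `psiK` can be computed at ANY exponent carrying `y` into the ball.
[folklore] -/
theorem psiK_eq_of_le (φ : Gal v7 ≃ₜ* Gal v7) {y : K7} {n : ℕ}
    (h : ‖(7 : K7) ^ n * y‖ ≤ ‖Omega‖) :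
    psiK φ y = ((7 : K7) ^ n)⁻¹ * psiBall φ ((7 : K7) ^ n * y) := by
  have hmin : extN y ≤ n := Nat.find_min' (exists_seven_pow_mul_mem_ball y) h
  obtain ⟨k, rfl⟩ := Nat.exists_eq_add_of_le hmin
  have h7' : ((7 : K7) ^ k) ≠ 0 := pow_ne_zero _ seven_ne_zero_K7
  have hsplit : (7 : K7) ^ (extN y + k) * y = (7 : K7) ^ k * ((7 : K7) ^ extN y * y) := by ring
  rw [psiK_def, hsplit, psiBall_seven_pow_mul φ k (extN_spec y), pow_add, mul_inv]
  set B := psiBall φ ((7 : K7) ^ extN y * y) with hB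
  calc ((7 : K7) ^ extN y)⁻¹ * B
      = ((7 : K7) ^ extN y)⁻¹ * (((7 : K7) ^ k)⁻¹ * (7 : K7) ^ k) * B := by
        rw [inv_mul_cancel₀ h7', mul_one]
    _ = ((7 : K7) ^ extN y)⁻¹ * ((7 : K7) ^ k)⁻¹ * ((7 : K7) ^ k * B) := by ring

/-- On the log-ball, `psiK = psiBall`. [folklore] -/
theorem psiK_of_mem_ball (φ : Gal v7 ≃ₜ* Gal v7) {z : K7} (hz : ‖z‖ ≤ ‖Omega‖) :
    psiK φ z = psiBall φ z := by
  have h0 : ‖(7 : K7) ^ 0 * z‖ ≤ ‖Omega‖ := by rwa [pow_zero, one_mul]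
  rw [psiK_eq_of_le φ h0, pow_zero, inv_one, one_mul, one_mul]

/-- **`psiK` realises the units transport on log values.**
[cite: MochizukiAbsTopIII2015, Proposition 3.2 (iv) p.72] -/
theorem psiK_unitLog_xval (φ : Gal v7 ≃ₜ* Gal v7) (u : (↥(v7.adicCompletionIntegers ↥F7))ˣ) :
    psiK φ (unitLog (xval u)) = unitLog (xval (liftUnits v7 φ u)) := by
  rw [psiK_of_mem_ball φ (norm_unitLog_xval u), psiBall_unitLog_xval]

/-- **`psiK` is additive** (compute all three values at a common exponent). [folklore] -/
theorem psiK_add (φ : Gal v7 ≃ₜ* Gal v7) (y w : K7) : psiK φ (y + w) = psiK φ y + psiK φ w := by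
  set N := max (extN y) (extN w) with hN
  have hy : ‖(7 : K7) ^ N * y‖ ≤ ‖Omega‖ :=
    seven_pow_mul_mem_ball_of_le (le_max_left _ _) (extN_spec y)
  have hw : ‖(7 : K7) ^ N * w‖ ≤ ‖Omega‖ :=
    seven_pow_mul_mem_ball_of_le (le_max_right _ _) (extN_spec w)
  have hyw : ‖(7 : K7) ^ N * (y + w)‖ ≤ ‖Omega‖ := by
    rw [mul_add]
    exact (norm_add_le_max _ _).trans (max_le hy hw)
  rw [psiK_eq_of_le φ hyw, psiK_eq_of_le φ hy, psiK_eq_of_le φ hw, mul_add,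
    psiBall_add φ hy hw, mul_add]

/-- `psiK φ 0 = 0`. [folklore] -/
theorem psiK_zero (φ : Gal v7 ≃ₜ* Gal v7) : psiK φ 0 = 0 := by
  have h0 : ‖(0 : K7)‖ ≤ ‖Omega‖ := by
    rw [norm_zero]
    exact norm_omega_pos_lt_one.1.le
  rw [psiK_of_mem_ball φ h0, psiBall_zero]

/-- **The global inverse law**: `psiK φ⁻¹ ∘ psiK φ = id`. [folklore] -/
theorem psiK_symm_psiK (φ : Gal v7 ≃ₜ* Gal v7) (y : K7) : psiK φ.symm (psiK φ y) = y := by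
  have h7 : ((7 : K7) ^ extN y) ≠ 0 := pow_ne_zero _ seven_ne_zero_K7
  have h1 : (7 : K7) ^ extN y * psiK φ y = psiBall φ ((7 : K7) ^ extN y * y) := by
    rw [psiK_def, ← mul_assoc, mul_inv_cancel₀ h7, one_mul]
  have hcoh : ‖(7 : K7) ^ extN y * psiK φ y‖ ≤ ‖Omega‖ := by
    rw [h1]
    exact norm_psiBall_le φ _
  rw [psiK_eq_of_le φ.symm hcoh, h1, psiBall_symm_psiBall φ (extN_spec y), ← mul_assoc,
    inv_mul_cancel₀ h7, one_mul]

/-! ## 5. The realisation `psiStrip φ`, its bicontinuity, and `Realises` -/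

/-- The transported map as an additive automorphism of `K₇` (inverse: the transport at `φ⁻¹`).
[cite: MochizukiAbsTopIII2015, Proposition 3.2 (iv) p.72] -/
def psiStripK (φ : Gal v7 ≃ₜ* Gal v7) : K7 ≃+ K7 :=
  AddEquiv.mk'
    ⟨psiK φ, psiK φ.symm, psiK_symm_psiK φ, fun y => by
      have h := psiK_symm_psiK φ.symm y
      rwa [ContinuousMulEquiv.symm_symm] at h⟩
    (psiK_add φ)

/-- `psiStripK` applied. [folklore] -/
theorem psiStripK_apply (φ : Gal v7 ≃ₜ* Gal v7) (y : K7) : psiStripK φ y = psiK φ y := rfl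

/-- `psiStripK` inverted. [folklore] -/
theorem psiStripK_symm_apply (φ : Gal v7 ≃ₜ* Gal v7) (y : K7) :
    (psiStripK φ).symm y = psiK φ.symm y := rfl

/-- **THE REALISATION `ψ_φ = e₇⁻¹ ∘ psiK φ ∘ e₇` of the strip automorphism on `K_{v₇}`.**
[cite: MochizukiAbsTopIII2015, Proposition 3.2 (iv) p.72] [claim: Mochizuki2012, status: disputed] -/
def psiStrip (φ : Gal v7 ≃ₜ* Gal v7) : v7.adicCompletion ↥F7 ≃+ v7.adicCompletion ↥F7 :=
  (e7.toAddEquiv.trans (psiStripK φ)).trans e7.symm.toAddEquiv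

/-- `ψ_φ` applied. [folklore] -/
theorem psiStrip_apply (φ : Gal v7 ≃ₜ* Gal v7) (x : v7.adicCompletion ↥F7) :
    psiStrip φ x = e7.symm (psiK φ (e7 x)) := rfl

/-- `ψ_φ⁻¹` applied. [folklore] -/
theorem psiStrip_symm_apply (φ : Gal v7 ≃ₜ* Gal v7) (x : v7.adicCompletion ↥F7) :
    (psiStrip φ).symm x = e7.symm (psiK φ.symm (e7 x)) := rfl

/-- `psiK` respects negation. [folklore] -/
theorem psiK_neg (φ : Gal v7 ≃ₜ* Gal v7) (y : K7) : psiK φ (-y) = -psiK φ y := by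
  have h := psiK_add φ y (-y)
  rw [add_neg_cancel, psiK_zero] at h
  exact eq_neg_of_add_eq_zero_right h.symm

/-- **The scaled-ball bound**: `‖y‖ ≤ ‖Ω‖^{2n+1}` forces `‖psiK φ y‖ ≤ ‖Ω‖^{2n+1}` (the transport
preserves the `7`-power scaling tower of the log-ball). [folklore] -/
theorem norm_psiK_le_of_le (φ : Gal v7 ≃ₜ* Gal v7) {y : K7} {n : ℕ}
    (h : ‖y‖ ≤ ‖Omega‖ ^ (2 * n + 1)) : ‖psiK φ y‖ ≤ ‖Omega‖ ^ (2 * n + 1) := by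
  obtain ⟨h0, h1⟩ := norm_omega_pos_lt_one
  have h7 : (7 : K7) ≠ 0 := seven_ne_zero_K7
  have hpowid : (‖Omega‖ ^ 2) ^ n * ‖Omega‖ = ‖Omega‖ ^ (2 * n + 1) := by
    rw [← pow_mul, ← pow_succ]
  have hyball : ‖y‖ ≤ ‖Omega‖ := by
    refine h.trans ?_
    calc ‖Omega‖ ^ (2 * n + 1) ≤ ‖Omega‖ ^ 1 :=
          pow_le_pow_of_le_one h0.le h1.le (by omega)
      _ = ‖Omega‖ := pow_one _
  set w := ((7 : K7) ^ n)⁻¹ * y with hwdef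
  have hyw : y = (7 : K7) ^ n * w := by
    rw [hwdef, ← mul_assoc, mul_inv_cancel₀ (pow_ne_zero _ h7), one_mul]
  have hwball : ‖w‖ ≤ ‖Omega‖ := by
    rw [hwdef, norm_mul, norm_inv, norm_pow, norm_seven_K7]
    have hpos : (0 : ℝ) < (‖Omega‖ ^ 2) ^ n := by positivity
    rw [inv_mul_le_iff₀ hpos]
    calc ‖y‖ ≤ ‖Omega‖ ^ (2 * n + 1) := h
      _ = (‖Omega‖ ^ 2) ^ n * ‖Omega‖ := hpowid.symm
  rw [psiK_of_mem_ball φ hyball, hyw, psiBall_seven_pow_mul φ n hwball, norm_mul, norm_pow,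
    norm_seven_K7]
  calc (‖Omega‖ ^ 2) ^ n * ‖psiBall φ w‖ ≤ (‖Omega‖ ^ 2) ^ n * ‖Omega‖ := by
        have := norm_psiBall_le φ w
        gcongr
    _ = ‖Omega‖ ^ (2 * n + 1) := hpowid

/-- **`psiK` is continuous** (ε–δ from the scaled-ball bound and additivity). [folklore] -/
theorem continuous_psiK (φ : Gal v7 ≃ₜ* Gal v7) : Continuous (psiK φ) := by
  obtain ⟨h0, h1⟩ := norm_omega_pos_lt_one
  rw [Metric.continuous_iff]
  intro a ε hε
  obtain ⟨n, hn⟩ := exists_pow_lt_of_lt_one hε h1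
  refine ⟨‖Omega‖ ^ (2 * n + 1), by positivity, fun b hb => ?_⟩
  rw [dist_eq_norm] at hb ⊢
  have hsub : psiK φ b - psiK φ a = psiK φ (b - a) := by
    rw [sub_eq_add_neg, sub_eq_add_neg, psiK_add, psiK_neg]
  rw [hsub]
  calc ‖psiK φ (b - a)‖ ≤ ‖Omega‖ ^ (2 * n + 1) := norm_psiK_le_of_le φ hb.le
    _ ≤ ‖Omega‖ ^ n := pow_le_pow_of_le_one h0.le h1.le (by omega)
    _ < ε := hn

/-- **`ψ_φ` is continuous.** [folklore] -/
theorem continuous_psiStrip (φ : Gal v7 ≃ₜ* Gal v7) : Continuous ⇑(psiStrip φ) :=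
  continuous_psiK φ

/-- **`ψ_φ⁻¹` is continuous.** [folklore] -/
theorem continuous_psiStrip_symm (φ : Gal v7 ≃ₜ* Gal v7) : Continuous ⇑(psiStrip φ).symm :=
  continuous_psiK φ.symm

/-- **`ψ_φ` realises `stripMulAut v₇ φ` through the analytic logarithm `L₇` — for EVERY `φ`.**
[cite: MochizukiAbsTopIII2015, Proposition 3.2 (iv) p.72] [claim: Mochizuki2012, status: disputed] -/
theorem realises_psiStrip (φ : Gal v7 ≃ₜ* Gal v7) :
    Realises v7 L7 (stripMulAut v7 φ) (psiStrip φ) := by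
  rw [realises_stripMulAut_iff]
  intro u
  rw [L7_apply, L7_apply, psiStrip_apply, e7.apply_symm_apply, psiK_unitLog_xval]

/-- **`ψ_φ` lies in print's (Ind1) strip part at `v₇`, for EVERY `φ`.**
[claim: Mochizuki2012, status: disputed] -/
theorem psiStrip_mem_ind1StripOf (φ : Gal v7 ≃ₜ* Gal v7) : psiStrip φ ∈ ind1StripOf v7 L7 :=
  ⟨continuous_psiStrip φ, continuous_psiStrip_symm φ, φ, realises_psiStrip φ⟩

/-- **THE UNCONDITIONAL REALISATION THEOREM**: every topological automorphism of `G_{v₇}` admits a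
bicontinuous additive realisation through the analytic logarithm — the mono-anabelian functoriality
clause of the conditional (Ind1)-movers is a THEOREM at `v₇`, not a hypothesis.  The entire
(Ind1)-mover question at `v₇` is therefore the units-transport question about
`Aut_top(G_{v₇}) ↷ 𝒪_{v₇}^×`.  (Contrast local degree one, where the landed norm rigidity
`liftUnits_eq_self_of_localDeg_eq_one` kills the TRANSPORT instead.)
[cite: MochizukiAbsTopIII2015, Proposition 3.2 (iv) p.72] [claim: Mochizuki2012, status: disputed] -/
theorem exists_realises_stripMulAut (φ : Gal v7 ≃ₜ* Gal v7) :
    ∃ ψ : v7.adicCompletion ↥F7 ≃+ v7.adicCompletion ↥F7,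
      Continuous ⇑ψ ∧ Continuous ⇑ψ.symm ∧ Realises v7 L7 (stripMulAut v7 φ) ψ :=
  ⟨psiStrip φ, continuous_psiStrip φ, continuous_psiStrip_symm φ, realises_psiStrip φ⟩

/-! ## 6. The GAP-row payoff: movers from units-transport hypotheses ALONE -/

/-- **Generic mover**: if the units transport of `φ` moves `unitPreimage L₇ S`, then the realisation
`ψ_φ` moves `S`. [claim: Mochizuki2012, status: disputed] -/
theorem moves_of_liftUnits_mover {S : AddSubgroup (v7.adicCompletion ↥F7)}
    {φ : Gal v7 ≃ₜ* Gal v7}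
    (hm : ∃ u, u ∈ unitPreimage L7 S ∧ liftUnits v7 φ u ∉ unitPreimage L7 S) :
    ⇑(psiStrip φ) '' (S : Set (v7.adicCompletion ↥F7)) ≠ S := by
  obtain ⟨u₀, hu₀, hmove⟩ := hm
  intro hEq
  have hmem : psiStrip φ (L7 (Additive.ofMul u₀)) ∈
      ⇑(psiStrip φ) '' (S : Set (v7.adicCompletion ↥F7)) :=
    ⟨L7 (Additive.ofMul u₀), (mem_unitPreimage_iff L7 S u₀).mp hu₀, rfl⟩
  have hψ := realises_psiStrip φ
  rw [realises_stripMulAut_iff] at hψ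
  rw [hEq, hψ u₀, SetLike.mem_coe] at hmem
  exact hmove ((mem_unitPreimage_iff L7 S _).mpr hmem)

/-- **Print's (Ind1) strip part moves `S` as soon as SOME units transport moves `unitPreimage L₇ S`**
— the realisation clause is discharged in kernel. [claim: Mochizuki2012, status: disputed] -/
theorem ind1_strip_moves_of_liftUnits_mover {S : AddSubgroup (v7.adicCompletion ↥F7)}
    (h : ∃ φ : Gal v7 ≃ₜ* Gal v7,
      ∃ u, u ∈ unitPreimage L7 S ∧ liftUnits v7 φ u ∉ unitPreimage L7 S) :
    ∃ ψ ∈ ind1StripOf v7 L7, ⇑ψ '' (S : Set (v7.adicCompletion ↥F7)) ≠ S := by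
  obtain ⟨φ, hm⟩ := h
  exact ⟨psiStrip φ, psiStrip_mem_ind1StripOf φ, moves_of_liftUnits_mover hm⟩

/-- **GAP step (i) DISCHARGED — the base-line mover from the PUBLISHED input alone**: if some
`φ ∈ Aut_top(G_{v₇})`'s units transport moves the base-field unit line `unitPreimage L₇ baseSeg` —
EXACTLY the `L₇`-reading of the conclusion of Hoshi's Lemma 3.1 (v) at `k = K₇` (his continuous
`α^×` carrying `𝒪^×_{k^{(d=1)}}` off itself), nothing else — then print's (Ind1) strip part at `v₇`
moves `baseSeg`.  The realisation/functoriality clause of p476108's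
`ind1_strip_moves_baseSeg_of_mover` is now supplied by `exists_realises_stripMulAut`; no `ψ`, no
`Realises`, no continuity hypothesis remains.
[cite: Hoshi2024IntrinsicHodgeTate, Lemma 3.1 (v) pp.10–11]
[cite: MochizukiAbsTopIII2015, Proposition 3.2 (iv) p.72] [claim: Mochizuki2012, status: disputed] -/
theorem ind1_strip_moves_baseSeg_of_liftUnits_mover
    (h : ∃ φ : Gal v7 ≃ₜ* Gal v7,
      ∃ u, u ∈ unitPreimage L7 baseSeg ∧ liftUnits v7 φ u ∉ unitPreimage L7 baseSeg) :
    ∃ ψ ∈ ind1StripOf v7 L7,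
      ⇑ψ '' (baseSeg : Set (v7.adicCompletion ↥F7)) ≠ baseSeg :=
  ind1_strip_moves_of_liftUnits_mover h

/-- **GAP step (ii′) SHARPENED — the `∃`-horn at the `μ·U^{(2)}`-target in its weakest form**: a
units-level mover at `unitPreimage L₇ M₂` alone moves the ideal-shaped region `M₂`.  Strictly weaker
hypothesis than the exact-shear lifting statement (`ind1_strip_mover_of_lift`) and than the
HN-realised forms of p481593 (any realisation clause there is now redundant).
[claim: Mochizuki2012, status: disputed] -/
theorem ind1_strip_moves_M2_of_liftUnits_mover
    (h : ∃ φ : Gal v7 ≃ₜ* Gal v7,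
      ∃ u, u ∈ unitPreimage L7 M2 ∧ liftUnits v7 φ u ∉ unitPreimage L7 M2) :
    ∃ ψ ∈ ind1StripOf v7 L7, ⇑ψ '' (M2 : Set (v7.adicCompletion ↥F7)) ≠ M2 :=
  ind1_strip_moves_of_liftUnits_mover h

/-- **Subsumption check**: the original exact-shear conditional mover's conclusion re-derived from
the weakest form (via the landed criterion-currency witness `unitPreimage_M2_mover`).
[claim: Mochizuki2012, status: disputed] -/
theorem ind1_strip_mover_of_liftUnits_shear
    (hlift : ∃ φ : Gal v7 ≃ₜ* Gal v7, ∀ u, liftUnits v7 φ u = shearFun u) :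
    ∃ ψ ∈ ind1StripOf v7 L7, ⇑ψ '' (M2 : Set (v7.adicCompletion ↥F7)) ≠ M2 := by
  obtain ⟨φ, hφ⟩ := hlift
  obtain ⟨u₀, h1, h2⟩ := unitPreimage_M2_mover
  exact ind1_strip_moves_M2_of_liftUnits_mover ⟨φ, u₀, h1, by rw [hφ]; exact h2⟩

end Summit.ABC.IUTFork.Thm311.Real.UnitsShear

end
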